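import Summits.AtomisticToContinuum.HydrodynamicLimit.Theorems.OneFlightGossipEngineCollisionActivityTailsPreShockEnvelope
import Summits.AtomisticToContinuum.HydrodynamicLimit.Theorems.OneFlightGossipEngineOneFlightLayeredChaosRegimes
import Summits.AtomisticToContinuum.HydrodynamicLimit.Theorems.JParityClosureCollisionTightnessDomination
import Summits.AtomisticToContinuum.HydrodynamicLimit.Theorems.InformationPercolationEngineCollisionRateEnvelopeBoundConst
import Literature.MathematicalPhysics.KineticTheory.Sweep1CanonicalDataProofs
import Literature.MathematicalPhysics.KineticTheory.HardSphereBBGKYProofs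
import Literature.MathematicalPhysics.KineticTheory.HardSphereEulerProofs
import Literature.MathematicalPhysics.KineticTheory.PseudoTrajectoryComparisonData
import HarnessLib

/-!
# E0: the Gaussian envelope of the local Gibbs law AT TIME ZERO, general continuous profiles
# (`stub_lanfordEnvelopeR_initial`, crux stmt-AtomisticToContinuum-13481 `InformationPercolationEngine.CollisionRate`, line `Sketch`)

The crux `CollisionRate` is kernel-reduced to a marginal-envelope hypothesis (A) on the evolved local Gibbs law; (A)
follows from the crux item `BGEndpointRigidity.LanfordEnvelopeR` (the Lanford/BGSR Gaussian envelope of all BBGKY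
marginals of the law at time `t`, open at `t > 0` at fixed reduced density).  This file proves its `t = 0` SLICE for
GENERAL continuous positive profiles `(a₀, u₀, θ₀)`, which is static:

* `indicator_hsTransport_zero_canonicalDensity_ae_eq`: at time zero the transported density is the datum a.e. —
  on the good set `Φ_0 = id` (`HardSphereFlow.flow_zero`), off the hard-sphere domain both sides vanish, and
  `D ∖ good` is Lebesgue-null (`HardSphereFlow.measure_compl_good`); the marginals then agree a.e.
  (`nthMarginal_congr_ae`), and the flow disappears;
* `exists_localGibbsProfile_le_maxwellianBeta`: continuity on the compact torus bounds the profiles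
  (`Theorems.exists_profile_bounds`) and completing the square dominates the one-body profile by a centred Maxwellian,
  `a₀(x) M_{1,u₀(x),θ₀(x)}(v) ≤ C₁ M_β(v)`, `β = (2 sup θ₀)⁻¹` (`Theorems.exists_localGibbsProfile_le_const`);
* the mass `m = ∫ a₀ M = ∫ a₀ > 0` is divided out of the canonical density (`OLC.canonicalDensity_const_mul'`), leaving a
  datum `f₀ = m⁻¹ a₀ M` of mass one with `f₀ ≤ C' M_β`, `C' = m⁻¹ C₁`;
* GST 2013 Prop. 6.1.2 (first step) `LanfordEmpirical.nthMarginal_canonicalDensity_le_two_pow_mul`: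
  `f_{0,N+1}^{(s)} ≤ 2^s 𝟙_{D^s} f₀^{⊗s}` in the dilution regime `N (2ε_N)³ C' ≤ 1/2`, which at fixed reduced density
  (`(N+1) ε_N³ = σ³`) holds once `σ < σ₀ := (16 C' + 1)⁻¹` (`CollisionRate.regime_of_lt_inv`) — this is where `σ₀`
  depends on the profiles;
* the factor-by-factor Gaussian bound `f₀^{⊗s} ≤ K^s e^{-β E(Z_s)}`, `K = C' (2π/β)^{-3/2}`
  (`tensorPow_le_pow_mul_exp_neg_mul_configEnergy`).

Hence the envelope with `C = 2K`; orders `s > N + 1` have zero marginal.  The constant-profile, all-times twin is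
`CollisionRate.stub_envelopeBound_const`, whose proof is adapted here.

References: I. Gallagher, L. Saint-Raymond, B. Texier, *From Newton to Boltzmann* (2013), Prop. 6.1.2;
T. Bodineau, I. Gallagher, L. Saint-Raymond, Invent. Math. 203 (2016), Prop. 3.2, Prop. 4.1; H. Spohn, *Large Scale
Dynamics of Interacting Particles* (1991), Part I §2.3.
-/

open scoped BigOperators Topology Classical MeasureTheory ProbabilityTheory InnerProductSpace ENNReal
open Filter Set Function MeasureTheory
open Literature.Analysis.FluidPDE Literature.MathematicalPhysics.KineticTheory

noncomputable section

namespace Summit.AtomisticToContinuum.HydrodynamicLimit.Theorems.CollisionRate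

open Literature.Analysis.FunctionSpaces (maxwellianBeta)
open Summit.AtomisticToContinuum.HydrodynamicLimit.Theorems.OLC (canonicalDensity_const_mul')
open Summit.AtomisticToContinuum.HydrodynamicLimit.Theorems.CollisionActivityTailsPreShockEnvelope
  (localGibbsProfile_const_eq)

/-! ### §1 Time zero: the transported density is the datum, a.e. -/

/-- **Time zero, density form.** For every one-body profile `f`, `𝟙_D · (W_n ∘ Φ_{-0}) = W_n` Lebesgue-a.e., `W_n` the
canonical density of `f`: on the good set `Φ_0 = id` (`HardSphereFlow.flow_zero`), off the hard-sphere domain both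
sides vanish (the canonical density carries the indicator of `D`), and `D ∖ good` is Lebesgue-null
(`HardSphereFlow.measure_compl_good`). [folklore] -/
theorem indicator_hsTransport_zero_canonicalDensity_ae_eq (f : T3 × V3 → ℝ) {ε : ℝ} {n : ℕ}
    (Φ : HardSphereFlow (Torus.geometry (Fin 3)) ε n) :
    (hardSphereDomain (Torus.geometry (Fin 3)) n ε).indicator
        (hsTransport Φ 0 (canonicalDensity (Torus.geometry (Fin 3)) ε n f)) =ᵐ[volume]
      canonicalDensity (Torus.geometry (Fin 3)) ε n f := by
  have hnull : ∀ᵐ z ∂(volume : Measure (Config n (Fin 3) T3)),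
      z ∉ Φ.goodᶜ ∩ hardSphereDomain (Torus.geometry (Fin 3)) n ε := by
    have h := Φ.measure_compl_good
    rw [liouville_eq, Measure.restrict_apply Φ.measurableSet_good.compl] at h
    exact measure_eq_zero_iff_ae_notMem.1 h
  filter_upwards [hnull] with z hz
  by_cases hg : z ∈ Φ.good
  · rw [indicator_of_mem (Φ.good_subset hg), hsTransport_apply, neg_zero, Φ.flow_zero z hg]
  · have hzD : z ∉ hardSphereDomain (Torus.geometry (Fin 3)) n ε := fun hD => hz ⟨hg, hD⟩
    rw [indicator_of_notMem hzD, canonicalDensity, indicator_of_notMem hzD, mul_zero]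

/-! ### §2 The one-body profile: Gaussian domination, positive mass -/

/-- **Gaussian domination of the local Gibbs profile by a centred Maxwellian.** For continuous profiles with
`a₀, θ₀ > 0` there are `β > 0` (namely `(2 sup θ₀)⁻¹`) and `C > 0` with `a₀(x) M_{1,u₀(x),θ₀(x)}(v) ≤ C M_β(v)`
(`Theorems.exists_profile_bounds`, `Theorems.exists_localGibbsProfile_le_const`, and `M_{1,0,2Θ} = M_{(2Θ)⁻¹}`).
[folklore] -/
theorem exists_localGibbsProfile_le_maxwellianBeta {a₀ θ₀ : T3 → ℝ} {u₀ : T3 → V3}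
    (ha : Continuous a₀) (hθ : Continuous θ₀) (hu : Continuous u₀)
    (ha0 : ∀ x, 0 < a₀ x) (hθ0 : ∀ x, 0 < θ₀ x) :
    ∃ β C : ℝ, 0 < β ∧ 0 < C ∧
      ∀ y : T3 × V3, localGibbsProfile a₀ u₀ θ₀ y ≤ C * maxwellianBeta β y.2 := by
  obtain ⟨A, a, Θ, ϑ, U, -, hϑ0, -, hA, -, hΘ, hϑ, hU⟩ := exists_profile_bounds ha hθ hu ha0 hθ0
  have hΘ0 : 0 < Θ := hϑ0.trans_le ((hϑ 0).trans (hΘ 0))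
  obtain ⟨C, hC0, hC⟩ := exists_localGibbsProfile_le_const (fun x => (ha0 x).le) hA hϑ0 hϑ hΘ hU
  refine ⟨(2 * Θ)⁻¹, C, by positivity, hC0, fun y => ?_⟩
  have h := hC y
  rw [localGibbsProfile_const_eq] at h
  simpa only [one_mul] using h

/-- The local Gibbs profile of positive profiles is positive everywhere. [folklore] -/
theorem localGibbsProfile_pos_of_pos {a₀ θ₀ : T3 → ℝ} {u₀ : T3 → V3}
    (ha0 : ∀ x, 0 < a₀ x) (hθ0 : ∀ x, 0 < θ₀ x) (y : T3 × V3) : 0 < localGibbsProfile a₀ u₀ θ₀ y :=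
  mul_pos (ha0 y.1) (Literature.MathematicalPhysics.KineticTheory.localMaxwellian_pos one_pos (hθ0 y.1) _ _)

/-- **Positive mass.** For continuous profiles with `a₀, θ₀ > 0` the local Gibbs profile is integrable on `𝕋³ × ℝ³`
and has positive mass `∫ a₀ M > 0` (it is positive everywhere and Lebesgue measure charges open sets). [folklore] -/
theorem integral_localGibbsProfile_pos {a₀ θ₀ : T3 → ℝ} {u₀ : T3 → V3}
    (ha : Continuous a₀) (hθ : Continuous θ₀) (hu : Continuous u₀)
    (ha0 : ∀ x, 0 < a₀ x) (hθ0 : ∀ x, 0 < θ₀ x) :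
    Integrable (localGibbsProfile a₀ u₀ θ₀) ∧ 0 < ∫ y, localGibbsProfile a₀ u₀ θ₀ y := by
  obtain ⟨β, C, hβ, -, hdom⟩ := exists_localGibbsProfile_le_maxwellianBeta ha hθ hu ha0 hθ0
  have hP0 : 0 ≤ localGibbsProfile a₀ u₀ θ₀ := fun y => (localGibbsProfile_pos_of_pos ha0 hθ0 y).le
  have hPi : Integrable (localGibbsProfile a₀ u₀ θ₀) :=
    LanfordEmpirical.integrable_of_le_maxwellianBeta hβ (measurable_localGibbsProfile ha hθ hu) hP0 hdom
  refine ⟨hPi, ?_⟩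
  rw [integral_pos_iff_support_of_nonneg hP0 hPi]
  have hsupp : support (localGibbsProfile a₀ u₀ θ₀) = univ :=
    eq_univ_of_forall fun y => (localGibbsProfile_pos_of_pos ha0 hθ0 y).ne'
  rw [hsupp]
  exact isOpen_univ.measure_pos volume univ_nonempty

/-! ### §3 The registered stub -/

/-- **E0 · THE ENVELOPE AT TIME ZERO, GENERAL PROFILES.** For continuous profiles `a₀, θ₀ > 0`, `u₀` there is
`σ₀ = (16 C' + 1)⁻¹`, `C' = m⁻¹ C₁` (`m = ∫ a₀` the mass, `a₀ M_{1,u₀,θ₀} ≤ C₁ M_β`, `β = (2 sup θ₀)⁻¹`), such that for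
`0 < σ < σ₀`, with `C = 2 C' (2π/β)^{-3/2}`: for every `N`, every hard-sphere flow and every order `s`, for a.e. `Z_s`
the `s`-marginal of `𝟙_D · (W_N ∘ Φ_{-0})`, `W_N` the canonical density of the local Gibbs profile, is at most
`C^s e^{-β E(Z_s)}` (time zero: `Φ_0 = id` a.e. on `D`; then GST 2013 Prop. 6.1.2, first step, for the normalised
datum `f₀ = m⁻¹ a₀ M ≤ C' M_β` in the dilution regime `N (2ε_N)³ C' ≤ 8σ³ C' ≤ 1/2`, and the factor-by-factor Gaussian
bound on `f₀^{⊗s}`). [cite: GST2013, Prop. 6.1.2] -/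
theorem stub_lanfordEnvelopeR_initial :
    ∀ (a₀ θ₀ : T3 → ℝ) (u₀ : T3 → V3), Continuous a₀ → Continuous θ₀ → Continuous u₀ →
      (∀ x, 0 < a₀ x) → (∀ x, 0 < θ₀ x) → ∃ σ₀ : ℝ, 0 < σ₀ ∧ ∀ σ : ℝ, 0 < σ → σ < σ₀ → ∃ β C : ℝ, 0 < β ∧ 0 ≤ C ∧
      ∀ (N : ℕ) (Φ : HardSphereFlow (Torus.geometry (Fin 3)) (hsDiameter σ N) (N + 1)) (s : ℕ),
      ∀ᵐ Zs : Config s (Fin 3) T3,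
        |nthMarginal (N + 1) s ((hardSphereDomain (Torus.geometry (Fin 3)) (N + 1) (hsDiameter σ N)).indicator
            (hsTransport Φ 0 (canonicalDensity (Torus.geometry (Fin 3)) (hsDiameter σ N) (N + 1)
              (localGibbsProfile a₀ u₀ θ₀)))) Zs| ≤ C ^ s * Real.exp (-(β * configEnergy Zs)) := by
  intro a₀ θ₀ u₀ ha hθ hu ha0 hθ0
  -- Gaussian domination of the profile and the closed form of the dominating Maxwellian
  obtain ⟨β, C₁, hβ, hC₁, hdom⟩ := exists_localGibbsProfile_le_maxwellianBeta ha hθ hu ha0 hθ0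
  obtain ⟨cβ, hcβ, hcβeq⟩ : ∃ c : ℝ, 0 < c ∧
      ∀ v : V3, maxwellianBeta β v = c * Real.exp (-(β / 2) * ‖v‖ ^ 2) :=
    ⟨_, Real.rpow_pos_of_pos (by positivity) _, maxwellianBeta_eq β⟩
  -- the profile: measurable, nonnegative, of positive mass `m`
  have hPm : Measurable (localGibbsProfile a₀ u₀ θ₀) := measurable_localGibbsProfile ha hθ hu
  have hP0 : 0 ≤ localGibbsProfile a₀ u₀ θ₀ := fun y => (localGibbsProfile_pos_of_pos ha0 hθ0 y).le
  have hm := (integral_localGibbsProfile_pos ha hθ hu ha0 hθ0).2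
  set m : ℝ := ∫ y, localGibbsProfile a₀ u₀ θ₀ y with hmdef
  -- the normalised datum `f₀ = m⁻¹ a₀ M`: mass one, `f₀ ≤ C' M_β`, `C' = m⁻¹ C₁`
  set f₀ : T3 × V3 → ℝ := fun y => m⁻¹ * localGibbsProfile a₀ u₀ θ₀ y with hf₀def
  have hf₀m : Measurable f₀ := hPm.const_mul _
  have hf₀0 : 0 ≤ f₀ := fun y => mul_nonneg (inv_nonneg.2 hm.le) (hP0 y)
  have hC' : 0 < m⁻¹ * C₁ := mul_pos (inv_pos.2 hm) hC₁
  have hf₀b : ∀ z : T3 × V3, f₀ z ≤ m⁻¹ * C₁ * maxwellianBeta β z.2 := fun z => by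
    rw [mul_assoc]
    exact mul_le_mul_of_nonneg_left (hdom z) (inv_nonneg.2 hm.le)
  have hf₀K : ∀ (x : T3) (v : V3), f₀ (x, v) ≤ m⁻¹ * C₁ * cβ * Real.exp (-(β / 2) * ‖v‖ ^ 2) :=
    fun x v => by
    have h := hf₀b (x, v)
    rw [hcβeq, ← mul_assoc] at h
    exact h
  have hf₀1 : ∫ z, f₀ z = 1 := by
    show ∫ z, m⁻¹ * localGibbsProfile a₀ u₀ θ₀ z = 1
    rw [integral_const_mul]
    exact inv_mul_cancel₀ hm.ne'
  refine ⟨(16 * (m⁻¹ * C₁) + 1)⁻¹, by positivity, fun σ hσ hσlt =>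
    ⟨β, 2 * (m⁻¹ * C₁ * cβ), hβ, by positivity, ?_⟩⟩
  intro N Φ s
  -- the mass divides out of the canonical density
  have hW : canonicalDensity (Torus.geometry (Fin 3)) (hsDiameter σ N) (N + 1) (localGibbsProfile a₀ u₀ θ₀) =
      canonicalDensity (Torus.geometry (Fin 3)) (hsDiameter σ N) (N + 1) f₀ :=
    (canonicalDensity_const_mul' _ _ _ (localGibbsProfile a₀ u₀ θ₀) (inv_ne_zero hm.ne')).symm
  -- time zero: the flow disappears a.e.
  have hae := Literature.MathematicalPhysics.KineticTheory.nthMarginal_congr_ae (s := s)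
    (indicator_hsTransport_zero_canonicalDensity_ae_eq (localGibbsProfile a₀ u₀ θ₀) Φ)
  filter_upwards [hae] with Zs hZs
  rw [hZs, hW]
  rcases le_or_gt s (N + 1) with hs | hs
  · have hnn : 0 ≤ nthMarginal (N + 1) s
        (canonicalDensity (Torus.geometry (Fin 3)) (hsDiameter σ N) (N + 1) f₀) Zs :=
      nthMarginal_nonneg (N + 1) s (LanfordEmpirical.canonicalDensity_nonneg' hf₀0) Zs
    rw [abs_of_nonneg hnn]
    refine (LanfordEmpirical.nthMarginal_canonicalDensity_le_two_pow_mul hβ hC'.le (hsDiameter_pos hσ N).le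
      hf₀m hf₀0 hf₀b hf₀1 hs (regime_of_lt_inv hC'.le hσ hσlt N) Zs).trans ?_
    calc 2 ^ s * (hardSphereDomain (Torus.geometry (Fin 3)) s (hsDiameter σ N)).indicator (tensorPow s f₀) Zs
        ≤ 2 ^ s * tensorPow s f₀ Zs :=
          mul_le_mul_of_nonneg_left (indicator_le_self' (fun w _ => tensorPow_nonneg hf₀0 s w) Zs)
            (by positivity)
      _ ≤ 2 ^ s * ((m⁻¹ * C₁ * cβ) ^ s * Real.exp (-β * configEnergy Zs)) :=
          mul_le_mul_of_nonneg_left (tensorPow_le_pow_mul_exp_neg_mul_configEnergy hf₀0 hf₀K s Zs)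
            (by positivity)
      _ = (2 * (m⁻¹ * C₁ * cβ)) ^ s * Real.exp (-(β * configEnergy Zs)) := by rw [mul_pow, neg_mul]; ring
  · have h0 : nthMarginal (N + 1) s
        (canonicalDensity (Torus.geometry (Fin 3)) (hsDiameter σ N) (N + 1) f₀) Zs = 0 := by
      simp [nthMarginal, not_le.2 hs]
    rw [h0, abs_zero]
    positivity

end Summit.AtomisticToContinuum.HydrodynamicLimit.Theorems.CollisionRate

end
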